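/-
Copyright (c) 2026. All rights reserved.
Released under Apache 2.0 license as described in the file LICENSE.
Authors: abc-iut cell, seat abc-iut-L4-t15 (gen 6).
-/
import Literature.GroupTheory.CommutatorProductHensel
import Literature.GroupTheory.QuasiMinimalNormal
import Literature.GroupTheory.PByMetacyclicTopLayer
import Literature.GroupTheory.PByMetacyclicLayers

/-!
# Exact lifting through a quasi-minimal normal subgroup (p-group-by-metacyclic setting)

Setting (a finite group `G`, cf. `Literature/GroupTheory/PByMetacyclicChiefFactors.lean`): `P ⊴ G` a
normal `p`-subgroup, `t, s ∈ G` with conjugates of `t` in `⟨t⟩P`, `t ^ e ∈ P` (`e` coprime to `p`),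
conjugates of `s` in `⟨t⟩ s P`; a slot tuple `g : Fin d → G` generating `G`, every slot lying in `P` or
equal to `t` or to `s`, containing `t` and `s`, and `P` the normal closure of the slots lying in `P`.
For a conjugating tuple `c` and entries `x` write `Φ_{c•g}(x) = ∏_j ⁅x j, c j * g j * (c j)⁻¹⁆`.

* `lift_through_qmn` — if `N ≤ P` is a quasi-minimal normal subgroup of `G`, then approximate solutions
  modulo `N` lift to EXACT solutions without new slots: for `Hn ⊴ G` containing `N`, any `c, κ` and
  entries `x j ∈ Hn` with `κ⁻¹ Φ_{c•g}(x) ∈ N`, there are `x' j ∈ Hn` with `κ⁻¹ Φ_{c•g}(x') = 1`.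
  The descent runs along `N ⊇ Z ⊇ ⁅Z,G⁆ ⊇ ⁅Z,G,G⁆ ⊇ ⋯ ⊇ 1` (`Z = Z_N`), using the chief-factor layer
  (a fixed-point-free generator among `t, s`), the pairing layer (`Z ≤ ⁅N,P⁆·⁅Z,G⁆`) and the central
  layers.

This is the inductive step of the bounded commutator width theorem
(`Literature/GroupTheory/BoundedCommutatorWidthPByMetacyclic.lean`).  Finite group theory over Mathlib;
no definitions, no instances (cell abc-iut, GAP-LEDGER G-L3d2g2-1).
-/

namespace Literature.GroupTheory

open scoped commutatorElement

universe u

variable {G : Type u} [Group G]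

/-! ### Descending a finite chain of solvable layers from a given approximate solution -/

/-- Hensel descent along `A 0 ⊇ A 1 ⊇ ⋯ ⊇ A r` starting from a given approximate solution modulo `A 0`
(iterate `exists_prod_commutator_mem_step`). [cite: NikolovSegal2007, §4] -/
theorem exists_prod_commutator_mem_of_layers_init {d : ℕ} (H : Subgroup G) [H.Normal]
    (g : Fin d → G) (A : ℕ → Subgroup G) (hAn : ∀ i, (A i).Normal) (r : ℕ)
    (hstep : ∀ i < r, ∀ c' : Fin d → G, ∀ κ ∈ A i, ∃ y : Fin d → G, (∀ j, y j ∈ H) ∧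
      κ⁻¹ * (List.ofFn fun j => ⁅y j, c' j * g j * (c' j)⁻¹⁆).prod ∈ A (i + 1))
    (c : Fin d → G) (κ : G) (x : Fin d → G) (hx : ∀ j, x j ∈ H)
    (hκ : κ⁻¹ * (List.ofFn fun j => ⁅x j, c j * g j * (c j)⁻¹⁆).prod ∈ A 0) :
    ∃ x' : Fin d → G, (∀ j, x' j ∈ H) ∧
      κ⁻¹ * (List.ofFn fun j => ⁅x' j, c j * g j * (c j)⁻¹⁆).prod ∈ A r := by
  have main : ∀ i ≤ r, ∃ x' : Fin d → G, (∀ j, x' j ∈ H) ∧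
      κ⁻¹ * (List.ofFn fun j => ⁅x' j, c j * g j * (c j)⁻¹⁆).prod ∈ A i := by
    intro i
    induction i with
    | zero => exact fun _ => ⟨x, hx, hκ⟩
    | succ i ih =>
      intro hi
      obtain ⟨x₁, hx₁, h₁⟩ := ih (Nat.le_of_succ_le hi)
      haveI := hAn i; haveI := hAn (i + 1)
      exact exists_prod_commutator_mem_step H (A i) (A (i + 1)) g c
        (hstep i (Nat.lt_of_succ_le hi)) κ x₁ hx₁ h₁
  exact main r le_rfl

/-! ### Lifting through a quasi-minimal normal subgroup -/

/-- **Exact lifting through a QMN.** In the setting of the module docstring, let `N ≤ P` be a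
quasi-minimal normal subgroup of the finite group `G` (`N ⊴ G`, `⁅N, G⁆ = N ≠ 1`, and every normal
`A < N` with `⁅A, G⁆ = A` is trivial).  Then for every normal `Hn ⊇ N`, every conjugating tuple `c`,
every `κ` and entries `x j ∈ Hn` with `κ⁻¹ * Φ_{c•g}(x) ∈ N` there are entries `x' j ∈ Hn` with
`κ⁻¹ * Φ_{c•g}(x') = 1` — the number of commutator factors is unchanged.
[cite: NikolovSegal2007, Proposition 4.4] -/
theorem lift_through_qmn [Finite G] {p : ℕ} [Fact p.Prime] (P : Subgroup G) [hP : P.Normal]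
    (hPp : IsPGroup p P) (t s : G) {e : ℕ} (hte : t ^ e ∈ P) (hpe : p.Coprime e)
    (ht_conj : ∀ w : G, ∃ a : ℕ, ∃ y ∈ P, w * t * w⁻¹ = t ^ a * y)
    (hs_conj : ∀ w : G, ∃ a : ℕ, ∃ y ∈ P, w * s * w⁻¹ = t ^ a * s * y)
    {d : ℕ} (g : Fin d → G) (hgen : Subgroup.closure (Set.range g) = ⊤)
    (hslots : ∀ j, g j ∈ P ∨ g j = t ∨ g j = s) (jt js : Fin d) (hjt : g jt = t) (hjs : g js = s)
    (hPgen : P ≤ Subgroup.normalClosure {x | x ∈ Set.range g ∧ x ∈ P})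
    (N : Subgroup G) [hN : N.Normal] (hNP : N ≤ P) (hNG : ⁅N, (⊤ : Subgroup G)⁆ = N) (hN1 : N ≠ ⊥)
    (hmin : ∀ A : Subgroup G, A.Normal → A < N → ⁅A, (⊤ : Subgroup G)⁆ = A → A = ⊥)
    (Hn : Subgroup G) [hHn : Hn.Normal] (hNHn : N ≤ Hn)
    (c : Fin d → G) (κ : G) (x : Fin d → G) (hx : ∀ j, x j ∈ Hn)
    (hκ : κ⁻¹ * (List.ofFn fun j => ⁅x j, c j * g j * (c j)⁻¹⁆).prod ∈ N) :
    ∃ x' : Fin d → G, (∀ j, x' j ∈ Hn) ∧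
      κ⁻¹ * (List.ofFn fun j => ⁅x' j, c j * g j * (c j)⁻¹⁆).prod = 1 := by
  classical
  -- `G` is generated by `P ∪ {t, s}`
  have hGgen : Subgroup.closure ((P : Set G) ∪ {t, s}) = ⊤ := by
    rw [eq_top_iff, ← hgen, Subgroup.closure_le]
    rintro _ ⟨j, rfl⟩
    rcases hslots j with h | h | h
    · exact Subgroup.subset_closure (Or.inl h)
    · exact Subgroup.subset_closure (Or.inr (by simp [h]))
    · exact Subgroup.subset_closure (Or.inr (by simp [h]))
  -- the subgroup `Z = Z_N` and its properties
  obtain ⟨Z, hZn, hZN, hZmax⟩ := exists_max_normal_lt_qmn N hNG hN1 hmin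
  haveI := hZn
  obtain ⟨cP, hcP⟩ := exists_lowerCentralSeries_eq_bot_of_isPGroup P hPp
  have hNPZ : ⁅N, P⁆ ≤ Z := commutator_le_of_qmn_le_nilpotent N Z P hN1 hZmax hNP hcP
  have hNNZ : ⁅N, N⁆ ≤ Z := (Subgroup.commutator_mono le_rfl hNP).trans hNPZ
  -- a slot whose conjugates all act fixed-point-freely on `N/Z`, and `Z ≤ ⁅N,P⁆ ⊔ ⁅Z,G⁆`
  have hkey : (∃ ju : Fin d, ∀ w : G, ∀ n ∈ N, ⁅n, w * g ju * w⁻¹⁆ ∈ Z → n ∈ Z) ∧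
      Z ≤ ⁅N, P⁆ ⊔ ⁅Z, (⊤ : Subgroup G)⁆ := by
    rcases fpf_or_triv_of_conj_mem_zpowers_mul P N Z t hNPZ hZmax ht_conj with hfpf | htriv
    · exact ⟨⟨jt, fun w => by rw [hjt]; exact fpf_conj N Z hfpf w⟩,
        le_commutator_sup_of_fpf_t P N Z t hNP hZN.le hNPZ hNG ht_conj hfpf⟩
    · have hsfpf := fpf_s_of_triv_t P N Z t s hNPZ hZN hNG hZmax hs_conj hGgen htriv
      exact ⟨⟨js, fun w => by rw [hjs]; exact fpf_conj N Z hsfpf w⟩,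
        le_commutator_sup_of_triv_t P N Z t s hNP hZN.le hNPZ hNG hGgen
          (commutator_mem_sup_of_triv_t P N Z hPp t hte hpe hNP hZN.le htriv) hsfpf⟩
  obtain ⟨⟨ju, hju⟩, hZD⟩ := hkey
  -- the hypercentral chain of `Z` reaches `1`
  obtain ⟨k, hk⟩ := exists_iterate_commutator_top_eq_bot_of_lt_qmn hmin Z hZN
  -- the chain `A 0 = N`, `A (i+1) = ⁅Z,_i G⁆`
  let A : ℕ → Subgroup G := fun i =>
    if i = 0 then N else (fun K : Subgroup G => ⁅K, (⊤ : Subgroup G)⁆)^[i - 1] Z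
  have hA0 : A 0 = N := by simp [A]
  have hAs : ∀ i, A (i + 1) = (fun K : Subgroup G => ⁅K, (⊤ : Subgroup G)⁆)^[i] Z := by
    intro i; simp [A]
  have hAn : ∀ i, (A i).Normal := by
    intro i
    cases i with
    | zero => rw [hA0]; exact hN
    | succ i => rw [hAs]; exact normal_iterate_commutator_top Z i
  -- layer solvability
  have hstep : ∀ i < k + 1, ∀ c' : Fin d → G, ∀ κ ∈ A i, ∃ y : Fin d → G, (∀ j, y j ∈ Hn) ∧
      κ⁻¹ * (List.ofFn fun j => ⁅y j, c' j * g j * (c' j)⁻¹⁆).prod ∈ A (i + 1) := by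
    intro i _ c' κ hκ
    rcases i with _ | i
    · -- chief-factor layer `(N, Z)`
      rw [hA0] at hκ
      obtain ⟨y, hyN, hy⟩ := layer_chief g N Z hNNZ ju hju c' κ hκ
      refine ⟨y, fun j => hNHn (hyN j), ?_⟩
      rw [hAs]; simpa using hy
    · rcases i with _ | i
      · -- pairing layer `(Z, ⁅Z, G⁆)`
        rw [hAs] at hκ
        simp only [Function.iterate_zero, id_eq] at hκ
        have hκD : κ ∈ ((⁅N, P⁆ ⊔ ⁅Z, (⊤ : Subgroup G)⁆ : Subgroup G) : Set G) := hZD hκ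
        rw [Subgroup.normal_mul] at hκD
        obtain ⟨w, hw, z₁, hz₁, rfl⟩ := Set.mem_mul.mp hκD
        have hNPE : ⁅⁅N, P⁆, (⊤ : Subgroup G)⁆ ≤ ⁅Z, (⊤ : Subgroup G)⁆ :=
          Subgroup.commutator_mono hNPZ le_rfl
        obtain ⟨y, hyN, -, hy⟩ := layer_pairing (fun j => c' j * g j * (c' j)⁻¹) N P
          ⁅Z, (⊤ : Subgroup G)⁆ hNPE (le_normalClosure_slots_conj g P hPgen c') hw
        refine ⟨y, fun j => hNHn (hyN j), ?_⟩
        rw [hAs]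
        simp only [Function.iterate_one]
        have : (w * z₁)⁻¹ * (List.ofFn fun j => ⁅y j, c' j * g j * (c' j)⁻¹⁆).prod =
            z₁⁻¹ * (w⁻¹ * (List.ofFn fun j => ⁅y j, c' j * g j * (c' j)⁻¹⁆).prod) := by group
        rw [this]
        exact Subgroup.mul_mem _ (Subgroup.inv_mem _ hz₁) hy
      · -- central layers `(⁅Z,_{i+1} G⁆, ⁅Z,_{i+2} G⁆)`
        rw [hAs, Function.iterate_succ_apply'] at hκ
        haveI := normal_iterate_commutator_top Z i
        haveI := normal_iterate_commutator_top Z (i + 2)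
        obtain ⟨y, hyA, hy⟩ := layer_central_conj g hgen
          ((fun K : Subgroup G => ⁅K, (⊤ : Subgroup G)⁆)^[i] Z)
          ((fun K : Subgroup G => ⁅K, (⊤ : Subgroup G)⁆)^[i + 2] Z)
          (by simp only [Function.iterate_succ_apply']; exact le_rfl) c' hκ
        refine ⟨y, fun j => hNHn (hZN.le (iterate_commutator_top_le Z i (hyA j))), ?_⟩
        rw [hAs]; exact hy
  -- descend
  have hκ0 : κ⁻¹ * (List.ofFn fun j => ⁅x j, c j * g j * (c j)⁻¹⁆).prod ∈ A 0 := by rw [hA0]; exact hκ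
  obtain ⟨x', hx', h'⟩ :=
    exists_prod_commutator_mem_of_layers_init Hn g A hAn (k + 1) hstep c κ x hx hκ0
  refine ⟨x', hx', ?_⟩
  rw [hAs, hk] at h'
  exact (Subgroup.mem_bot.mp h')

end Literature.GroupTheory
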